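/-
Copyright: fleet lead `ym-wcr-19609-p1` (seat prover-ym-wcr-19609-p1-g0-0), route `WeakCouplingRates`, crux
`BulkDominatesColdBoxW` (stmt-QuantumFields-19609), line `dlr-chessboard` (skeleton v4, sha16 355a68b80645dd42).
-/
import Summits.QuantumFields.YangMills.Theorems.WeakCouplingRatesColdBoxLargeField
import Summits.QuantumFields.YangMills.Theorems.WeakCouplingRatesBulkDominatesColdBoxWDefs

/-!
# The Gibbs large-field bound of the Wilson box kernel for a SMALL-LINK boundary datum (brick B2 toward the open
# stubs L1a/L1b of crux `BulkDominatesColdBoxW`, stmt-QuantumFields-19609)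

WHY.  The open stubs `stub_goodBoundaryCovStable` (L1a) / `stub_goodBoundaryMeanSmooth` (L1b) of the line `dlr-chessboard` are about
the box kernel `γ_Λ(·|ω) = ymSpecification ρ β Λ ω` uniformly over crude-good boundary data `ω`; after the comb gauge (brick B1,
`WeakCouplingRatesBulkDominatesColdBoxWAxialSmallLinks`) such a datum has all links within a small radius of `1`.  The first analytic input
of any one-scale treatment is then a large-field RARITY bound INSIDE the box under `γ_Λ(·|ω)`: the fleet lead ★ym-wcr-19456-p1 proved it
for the flat datum `ω ≡ 1` (`ymSpecification_one_real_le`, module `WeakCouplingRatesColdBoxLargeField`); this file is the same bound for an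
ARBITRARY datum all of whose links lie in the ball `‖ρ(ω_e) − 1‖ ≤ r`:

* `ymSpecification_ball_real_le` — `γ_Λ(E | ω) ≤ e^{−β s₀} · e^{8Nβr²·#Λ'} / c_b^{#Λ}` whenever the boundary Wilson action is `≥ s₀` on
  the measurable event `E`, `0 < c_b ≤ Haar{‖ρ g − 1‖ ≤ r}`, and `‖ρ(ω_e) − 1‖ ≤ r` for every edge `e` (numerator `≤ e^{−βs₀}`; normaliser
  `≥ e^{−8Nβr²#Λ'} · Haar(ball_r)^{#Λ}` by restricting the product Haar measure to the ball on every edge of `Λ` — the glued configuration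
  then lies in the ball on EVERY edge).  With `r = a ≫ β^{−1/2}` (the small-link radius of a crude-good datum) the exponent `8Nβa²#Λ'`
  replaces the flat `8N#Λ'`; the kernel only reads `ω` on the collar, so the all-edges hypothesis is harmless (replace `ω` off the collar).

Proof = the flat proof verbatim with `norm_glueWith_sub_one_le` (ball datum) in place of `norm_glueWith_one_sub_one_le`.
NOT a claim about the mass gap; general compact `G`, continuous unitary `ρ`, any finite `Λ`, `β ≥ 0`.

References: T. Bałaban, CMP 109 (1987) (0.15) (Laplace lower bound on `Z`); S. Chatterjee, arXiv:1602.01222 §9; L. Gross, CMP 92 (1983)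
Thm. 3.6 (shape of the tail).
-/

set_option autoImplicit false

noncomputable section

open MeasureTheory Finset
open scoped Matrix.Norms.L2Operator
open Literature.Probability.LatticeModels (glueWith glueWith_apply_mem glueWith_apply_not_mem
  measurable_glueWith)
open Literature.MathematicalPhysics Literature.MathematicalPhysics.QuantumLattice
open Literature.MathematicalPhysics.QuantumFieldTheory

namespace Summit.QuantumFields.YangMills.Theorems.WeakCouplingRates

section General

variable {d m : ℕ} [NeZero m] {G : Type*} [Group G]
variable (ρ : G →* Matrix (Fin m) (Fin m) ℂ) (hρu : ∀ g, ρ g ∈ Matrix.unitaryGroup (Fin m) ℂ)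

omit [NeZero m] in
/-- The gluing of a ball configuration INTO a ball datum lies in the ball on every edge. [folklore] -/
theorem norm_glueWith_sub_one_le {r : ℝ} {Λ : Finset (Literature.MathematicalPhysics.QuantumLattice.ZdEdge d)} {ζ : ↥Λ → G}
    (hζ : ∀ e, ‖ρ (ζ e) - 1‖ ≤ r) {η : LGConfig d G} (hη : ∀ e, ‖ρ (η e) - 1‖ ≤ r)
    (e : Literature.MathematicalPhysics.QuantumLattice.ZdEdge d) :
    ‖ρ (glueWith Λ ζ η e) - 1‖ ≤ r := by
  by_cases he : e ∈ Λ
  · rw [glueWith_apply_mem _ _ _ he]; exact hζ _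
  · rw [glueWith_apply_not_mem _ _ _ he]; exact hη e

variable [TopologicalSpace G] [IsTopologicalGroup G] [CompactSpace G] [MeasurableSpace G] [BorelSpace G]
  [SecondCountableTopology G]

include hρu in
/-- **Gibbs large-field bound for the Wilson box kernel with a small-link boundary datum.**  Let `ρ` be a continuous unitary
representation, `β ≥ 0`, `Λ` a finite edge set, `η` a boundary datum with `‖ρ(η_e) − 1‖ ≤ r` on EVERY edge, and `E` a measurable event on
which the boundary Wilson action is at least `s₀`.  Then for every `0 < c_b ≤ Haar{‖ρ g − 1‖ ≤ r}`,
`γ_Λ(E | η) ≤ e^{−β s₀} · e^{8Nβr²·#Λ'} / c_b^{#Λ}`, `Λ' =` the plaquettes touching `Λ` (numerator `≤ e^{−βs₀}`; normaliser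
`≥ e^{−8Nβr²#Λ'} · Haar(ball_r)^{#Λ}` by restricting to the ball on every edge of `Λ`).  The flat case `η ≡ 1` is
`ymSpecification_one_real_le`. [folklore] -/
theorem ymSpecification_ball_real_le (hρc : Continuous ρ) {β : ℝ} (hβ : 0 ≤ β)
    (Λ : Finset (Literature.MathematicalPhysics.QuantumLattice.ZdEdge d))
    {E : Set (LGConfig d G)} (hE : MeasurableSet E) {s₀ : ℝ}
    (hs : ∀ U ∈ E, s₀ ≤ wilsonBoundaryAction ρ Λ U) {r : ℝ} {cb : ℝ} (hcb : 0 < cb)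
    (hball : cb ≤ (haarProbability G).real {g : G | ‖ρ g - 1‖ ≤ r})
    {η : LGConfig d G} (hη : ∀ e, ‖ρ (η e) - 1‖ ≤ r) :
    (ymSpecification ρ β Λ η).real E ≤
      Real.exp (-(β * s₀)) * Real.exp (β * (#(plaquettesTouching Λ) * (8 * m * r ^ 2))) / cb ^ #Λ := by
  set π : Measure (↥Λ → G) := Measure.pi fun _ : ↥Λ => haarProbability G with hπ
  haveI : IsProbabilityMeasure π := by rw [hπ]; infer_instance
  set K : ℝ := #(plaquettesTouching Λ) * (8 * m * r ^ 2) with hK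
  set S : (↥Λ → G) → ℝ := fun ζ => wilsonBoundaryAction ρ Λ (glueWith Λ ζ η) with hS
  have hF : Measurable (E.indicator (1 : LGConfig d G → ℝ)) := measurable_const.indicator hE
  rw [← integral_indicator_one hE, integral_ymSpecification ρ hρc β Λ hF]
  -- continuity / measurability of the pulled-back weight
  have hSc : Continuous S := (continuous_wilsonBoundaryAction ρ hρc Λ).comp
    ((continuous_glueWith_prod Λ).comp (Continuous.prodMk_right η))
  have hwc : Continuous fun ζ => Real.exp (-β * S ζ) := Real.continuous_exp.comp (continuous_const.mul hSc)
  have hS0 : ∀ ζ, 0 ≤ S ζ := fun ζ => wilsonBoundaryAction_nonneg ρ hρu Λ _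
  have hw1 : ∀ ζ, Real.exp (-β * S ζ) ≤ 1 := fun ζ => by
    rw [Real.exp_le_one_iff]; nlinarith [hS0 ζ]
  -- numerator
  have hnum : ∫ ζ, E.indicator (1 : LGConfig d G → ℝ) (glueWith Λ ζ η) * Real.exp (-β * S ζ) ∂π ≤
      Real.exp (-(β * s₀)) := by
    have hpt : ∀ ζ, E.indicator (1 : LGConfig d G → ℝ) (glueWith Λ ζ η) * Real.exp (-β * S ζ) ≤
        Real.exp (-(β * s₀)) := fun ζ => by
      by_cases hζ : glueWith Λ ζ η ∈ E
      · rw [Set.indicator_of_mem hζ, Pi.one_apply, one_mul]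
        exact Real.exp_le_exp.2 (by nlinarith [hs _ hζ])
      · rw [Set.indicator_of_notMem hζ, zero_mul]; exact (Real.exp_pos _).le
    calc _ ≤ ∫ _ζ, Real.exp (-(β * s₀)) ∂π := by
          refine integral_mono_of_nonneg (ae_of_all _ fun ζ => ?_) (integrable_const _) (ae_of_all _ hpt)
          exact mul_nonneg (Set.indicator_nonneg (fun _ _ => zero_le_one) _) (Real.exp_pos _).le
      _ = Real.exp (-(β * s₀)) := by simp
  -- denominator
  set B : Set (↥Λ → G) := {ζ | ∀ e, ‖ρ (ζ e) - 1‖ ≤ r} with hB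
  have hBm : MeasurableSet B := by
    have hset : B = Set.pi Set.univ (fun _ : ↥Λ => {g : G | ‖ρ g - 1‖ ≤ r}) := by ext ζ; simp [hB]
    rw [hset]
    exact MeasurableSet.univ_pi fun _ =>
      (isClosed_le ((hρc.sub continuous_const).norm) continuous_const).measurableSet
  have hπB : π.real B = ((haarProbability G).real {g : G | ‖ρ g - 1‖ ≤ r}) ^ #Λ := by
    rw [measureReal_def, hπ, pi_ball_eq ρ Λ r, ENNReal.toReal_pow, ← measureReal_def]
  have hden : Real.exp (-(β * K)) * cb ^ #Λ ≤ ∫ ζ, Real.exp (-β * S ζ) ∂π := by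
    have h1 : Real.exp (-(β * K)) * cb ^ #Λ ≤ Real.exp (-(β * K)) * π.real B := by
      rw [hπB]
      exact mul_le_mul_of_nonneg_left (pow_le_pow_left₀ hcb.le hball _) (Real.exp_pos _).le
    have h2 : Real.exp (-(β * K)) * π.real B = ∫ ζ, B.indicator (fun _ => Real.exp (-(β * K))) ζ ∂π := by
      rw [integral_indicator_const _ hBm, smul_eq_mul, mul_comm]
    have h3 : ∫ ζ, B.indicator (fun _ => Real.exp (-(β * K))) ζ ∂π ≤ ∫ ζ, Real.exp (-β * S ζ) ∂π := by
      refine integral_mono_of_nonneg (ae_of_all _ fun ζ => ?_)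
        (QuantumLattice.integrable_of_bound hwc.aestronglyMeasurable (C := 1) fun ζ => ?_) (ae_of_all _ fun ζ => ?_)
      · exact Set.indicator_nonneg (fun _ _ => (Real.exp_pos _).le) _
      · rw [abs_of_pos (Real.exp_pos _)]; exact hw1 ζ
      · by_cases hζ : ζ ∈ B
        · rw [Set.indicator_of_mem hζ]
          refine Real.exp_le_exp.2 ?_
          have hle : S ζ ≤ K :=
            wilsonBoundaryAction_le_of_ball ρ hρu (norm_glueWith_sub_one_le ρ hζ hη) Λ
          nlinarith
        · rw [Set.indicator_of_notMem hζ]; exact (Real.exp_pos _).le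
    exact h1.trans (h2.le.trans h3)
  have hden0 : 0 < Real.exp (-(β * K)) * cb ^ #Λ := by positivity
  -- combine
  calc (∫ ζ, E.indicator (1 : LGConfig d G → ℝ) (glueWith Λ ζ η) * Real.exp (-β * S ζ) ∂π) /
        ∫ ζ, Real.exp (-β * S ζ) ∂π
      ≤ Real.exp (-(β * s₀)) / (Real.exp (-(β * K)) * cb ^ #Λ) :=
        div_le_div₀ (Real.exp_pos _).le hnum hden0 hden
    _ = Real.exp (-(β * s₀)) * Real.exp (β * K) / cb ^ #Λ := by
        rw [Real.exp_neg (β * K)]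
        field_simp

end General

end Summit.QuantumFields.YangMills.Theorems.WeakCouplingRates
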